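import Mathlib.Analysis.Calculus.ContDiff.Bounds
import Literature.Analysis.FunctionSpaces.TorusMollifierDerivBounds
import Literature.Analysis.FunctionSpaces.HolderInterpolation
import HarnessLib

/-!
# Geometric bounds `‖Dⁱ(f∘proj)‖_∞ ≤ C Lⁱ` (`i ≤ n`) on the flat torus: a Leibniz calculus in the
# Fréchet-derivative currency

Analysis/FunctionSpaces support file (one definition — a `Prop`-valued predicate with a body —
and its proved algebra; no named facts). The multiscale constructions of convex-integration type
(Buckmaster–Vicol, Luo–Titi; here M. P. Coiculescu, S. Palasek, Invent. Math. 244 (2025),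
arXiv:2503.14699, §3) estimate every building block in the form "each derivative costs a factor
of the frequency": `‖∇ᵐΨ⁰_{j,k}‖_∞ ≲_m N_k^{-2+m}` (Lemma 3.2 (1)), `‖∇ᵐψ⁰_k‖_∞ ≲_m N_k^{-1+m}`
(Prop. 3.7), `‖∇ᵐa_{j,k}‖_∞ ≲_m M_{k-1}^m N_k` ((abounds)), `‖∇ᵐv_k‖_∞ ≲ N_k^{1+m}e^{-N_k²t}` ((vkbounds)),
and the proofs are Leibniz-rule bookkeeping. The tree's `Torus.HasDerivBounds` (`TorusDerivBounds`)
packages such bounds for iterated PARTIAL derivatives; the target statement of Coiculescu–Palasek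
(`CoiculescuPalasek2025.IsApproximateSolution.deriv_le`: `eSupNorm (iteratedFDeriv ℝ m (lift (v t))) ≤ …`)
and the tree's mollifier and Mikado-potential estimates (`TorusMollifierAllOrders`,
`MikadoShearPotentialBounds`, `NashCoefficientFields`) are phrased with the full FRÉCHET derivatives
of the periodic lift. This file is the Fréchet twin:

* `Torus.HasLiftDerivBounds n f C L` — `f : T^d → F` is smooth and `‖Dⁱ(f∘proj)(y)‖ ≤ C Lⁱ` for all
  `i ≤ n` and all `y`;
* closure under: constants, sums, scalar multiples, linear maps (`clm_comp`), coordinates and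
  reassembly of Pi-valued and Euclidean-valued maps (`pi_apply`, `of_pi`, `euclidean_of_coord`), **products**
  (`mul`, `smul`: amplitudes multiply, frequencies ADD — `C_f C_g (L_f + L_g)ⁱ`, the binomial theorem
  applied to Mathlib's `norm_iteratedFDeriv_mul_le` / `norm_iteratedFDeriv_smul_le`), integer
  **dilations** `x ↦ f(M • x)` (`comp_nsmul`: `L ↦ M L`), translations, **derivatives**
  (`partialDeriv`, `lineDeriv`: order drops by one, amplitude gains `L`), and **mollification**
  (`kernel_convolution`: preserved, by `TorusMollifierDerivBounds`; `hasLiftDerivBounds_kernel_convolution_of_norm_le`: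
  all derivatives on the kernel, `L = c̄_n/ε`);
* read-outs: `norm_le` (`‖f‖_∞ ≤ C`), `norm_partialDeriv_le` (`‖∂ᵢf‖_∞ ≤ C L`), and the `eSupNorm`
  form `eSupNorm_iteratedFDeriv_lift_le` consumed by `deriv_le`-type statements.

## Mathlib / tree search

Mathlib: `norm_iteratedFDeriv_mul_le`, `norm_iteratedFDeriv_smul_le`, `norm_iteratedFDeriv_clm_apply_const`,
`ContinuousLinearMap.norm_iteratedFDeriv_comp_left`, `ContinuousLinearMap.iteratedFDeriv_comp_right`,
`iteratedFDeriv_comp_sub`, `norm_iteratedFDeriv_fderiv`, `add_pow`. Tree: `Torus.HasDerivBounds`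
(partial-derivative twin, `TorusDerivBounds`), `Torus.lift_lineDeriv` (`TorusCalculus`),
`Torus.norm_iteratedFDeriv_lift_kernel_convolution_le_of_forall_le(')` (`TorusMollifierAllOrders`,
`TorusMollifierDerivBounds`), `CP25.norm_iteratedFDeriv_lift_comp_nsmul_le` (`MikadoShearPotentialBounds`,
FluidPDE layer — re-derived inline here to keep the layering). `lean search 'HasLiftDerivBounds|Frechet.*DerivBounds'`: nothing prior.

## References

* L. C. Evans, *Partial Differential Equations*, 2nd ed., AMS 2010, §5.3 and App. C.4 (Leibniz formula,
  mollifiers). [Evans2010]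
* M. P. Coiculescu, S. Palasek, Invent. Math. 244 (2025) 165–219, arXiv:2503.14699, Lemma 3.2 (1),
  Lemma 3.6, Prop. 3.7, Prop. 3.13 ((abounds), (vkbounds)). [CoiculescuPalasek2025]
-/

noncomputable section

open Set Function MeasureTheory Filter
open scoped BigOperators ContDiff Convolution Topology

namespace Literature.Analysis.FunctionSpaces

namespace Torus

variable {d : Type*} [Fintype d] [DecidableEq d]
variable {F : Type*} [NormedAddCommGroup F] [NormedSpace ℝ F]
variable {G : Type*} [NormedAddCommGroup G] [NormedSpace ℝ G]

/-! ## The predicate -/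

/-- **Geometric bounds on all derivatives up to order `n` of the periodic lift**:
`f : T^d → F` is smooth and `‖Dⁱ(f ∘ proj)(y)‖ ≤ C Lⁱ` for every `i ≤ n` and every `y ∈ ℝ^d`
("each derivative costs a factor `L`", the shape `‖∇ᵐΨ⁰_{j,k}‖_{L^∞} ≲_m N_k^{-2+m}` of
Coiculescu–Palasek Lemma 3.2 (1), Prop. 3.7, (abounds)). [cite: CoiculescuPalasek2025, Lemma 3.2 (1)] -/
def HasLiftDerivBounds (n : ℕ) (f : UnitAddTorus d → F) (C L : ℝ) : Prop :=
  IsSmooth f ∧ ∀ i ≤ n, ∀ y : EuclideanSpace ℝ d, ‖iteratedFDeriv ℝ i (lift f) y‖ ≤ C * L ^ i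

namespace HasLiftDerivBounds

variable {n : ℕ} {f g : UnitAddTorus d → F} {C C' L L' : ℝ}

omit [DecidableEq d] in
/-- The function is smooth. [folklore] -/
theorem isSmooth (h : HasLiftDerivBounds n f C L) : IsSmooth f := h.1

omit [DecidableEq d] in
/-- The bound on the `i`-th derivative, `i ≤ n`. [folklore] -/
theorem bound (h : HasLiftDerivBounds n f C L) {i : ℕ} (hi : i ≤ n) (y : EuclideanSpace ℝ d) :
    ‖iteratedFDeriv ℝ i (lift f) y‖ ≤ C * L ^ i := h.2 i hi y

omit [DecidableEq d] in
/-- The lift is `Cⁿ`. [folklore] -/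
theorem contDiff (h : HasLiftDerivBounds n f C L) : ContDiff ℝ n (lift f) :=
  h.1.of_le (by exact_mod_cast le_top)

omit [DecidableEq d] in
/-- Order zero: `‖f(x)‖ ≤ C`. [folklore] -/
theorem norm_le (h : HasLiftDerivBounds n f C L) (x : UnitAddTorus d) : ‖f x‖ ≤ C := by
  obtain ⟨y, rfl⟩ := proj_surjective x
  have h0 := h.bound (Nat.zero_le n) y
  rwa [norm_iteratedFDeriv_zero, lift_apply, pow_zero, mul_one] at h0

omit [DecidableEq d] in
/-- The amplitude constant is nonnegative. [folklore] -/
theorem nonneg (h : HasLiftDerivBounds n f C L) : 0 ≤ C := (norm_nonneg _).trans (h.norm_le 0)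

omit [DecidableEq d] in
/-- Lowering the order. [folklore] -/
theorem of_le (h : HasLiftDerivBounds n f C L) {m : ℕ} (hm : m ≤ n) : HasLiftDerivBounds m f C L :=
  ⟨h.1, fun i hi y => h.2 i (hi.trans hm) y⟩

omit [DecidableEq d] in
/-- Weakening the constants (`C ≤ C'`, `0 ≤ L ≤ L'`). [folklore] -/
theorem mono (h : HasLiftDerivBounds n f C L) (hC : C ≤ C') (hL : 0 ≤ L) (hL' : L ≤ L') :
    HasLiftDerivBounds n f C' L' :=
  ⟨h.1, fun i hi y => (h.2 i hi y).trans
    (mul_le_mul hC (pow_le_pow_left₀ hL hL' i) (pow_nonneg hL i) (h.nonneg.trans hC))⟩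

omit [DecidableEq d] in
/-- `eSupNorm` form of the bounds (the shape of `deriv_le`-type statements). [folklore] -/
theorem eSupNorm_iteratedFDeriv_lift_le (h : HasLiftDerivBounds n f C L) {i : ℕ} (hi : i ≤ n) :
    eSupNorm (iteratedFDeriv ℝ i (lift f)) ≤ ENNReal.ofReal (C * L ^ i) :=
  eSupNorm_le_ofReal fun y => h.bound hi y

end HasLiftDerivBounds

/-! ## Constants and linear structure -/

section Linear

variable {n : ℕ} {f g : UnitAddTorus d → F} {C Cf Cg L : ℝ}

omit [DecidableEq d] in
/-- Constants: `HasLiftDerivBounds n (fun _ => c) ‖c‖ L` for `L ≥ 0`. [folklore] -/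
theorem hasLiftDerivBounds_const (n : ℕ) (c : F) (hL : 0 ≤ L) :
    HasLiftDerivBounds n (fun _ : UnitAddTorus d => c) ‖c‖ L := by
  refine ⟨isSmooth_const c, fun i hi y => ?_⟩
  rcases Nat.eq_zero_or_pos i with rfl | hpos
  · simp [lift]
  · have : lift (fun _ : UnitAddTorus d => c) = fun _ => c := rfl
    rw [this, iteratedFDeriv_const_of_ne hpos.ne' c, Pi.zero_apply, norm_zero]
    positivity

omit [DecidableEq d] in
/-- The zero function. [folklore] -/
theorem hasLiftDerivBounds_zero (n : ℕ) (hL : 0 ≤ L) :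
    HasLiftDerivBounds n (fun _ : UnitAddTorus d => (0 : F)) 0 L := by
  simpa using hasLiftDerivBounds_const (d := d) n (0 : F) hL

namespace HasLiftDerivBounds

omit [DecidableEq d] in
/-- Sums (same frequency `L`): amplitudes add. [folklore] -/
theorem add (hf : HasLiftDerivBounds n f Cf L) (hg : HasLiftDerivBounds n g Cg L) :
    HasLiftDerivBounds n (fun y => f y + g y) (Cf + Cg) L := by
  refine ⟨hf.1.add hg.1, fun i hi y => ?_⟩
  have hl : lift (fun y => f y + g y) = lift f + lift g := rfl
  rw [hl, iteratedFDeriv_add_apply (hf.contDiff.of_le (by exact_mod_cast hi)).contDiffAt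
    (hg.contDiff.of_le (by exact_mod_cast hi)).contDiffAt, add_mul]
  exact (norm_add_le _ _).trans (add_le_add (hf.bound hi y) (hg.bound hi y))

omit [DecidableEq d] in
/-- Negation. [folklore] -/
theorem neg (hf : HasLiftDerivBounds n f Cf L) : HasLiftDerivBounds n (fun y => -f y) Cf L := by
  refine ⟨hf.1.neg, fun i hi y => ?_⟩
  have hl : lift (fun y => -f y) = -lift f := rfl
  rw [hl, iteratedFDeriv_neg_apply, norm_neg]
  exact hf.bound hi y

omit [DecidableEq d] in
/-- Differences. [folklore] -/
theorem sub (hf : HasLiftDerivBounds n f Cf L) (hg : HasLiftDerivBounds n g Cg L) :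
    HasLiftDerivBounds n (fun y => f y - g y) (Cf + Cg) L := by
  simpa [sub_eq_add_neg] using hf.add hg.neg

omit [DecidableEq d] in
/-- Scalar multiples: `HasLiftDerivBounds n (c • f) (|c| C) L`. [folklore] -/
theorem const_smul (hf : HasLiftDerivBounds n f Cf L) (c : ℝ) :
    HasLiftDerivBounds n (fun y => c • f y) (|c| * Cf) L := by
  refine ⟨hf.1.smul c, fun i hi y => ?_⟩
  have hl : lift (fun y => c • f y) = fun y => c • lift f y := rfl
  rw [hl, iteratedFDeriv_const_smul_apply' (hf.contDiff.of_le (by exact_mod_cast hi)).contDiffAt,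
    norm_smul, Real.norm_eq_abs, mul_assoc]
  exact mul_le_mul_of_nonneg_left (hf.bound hi y) (abs_nonneg c)

omit [DecidableEq d] in
/-- Real multiples of a real function. [folklore] -/
theorem const_mul {f : UnitAddTorus d → ℝ} (hf : HasLiftDerivBounds n f Cf L) (c : ℝ) :
    HasLiftDerivBounds n (fun y => c * f y) (|c| * Cf) L :=
  hf.const_smul c

omit [DecidableEq d] in
/-- Finite sums (same frequency). [folklore] -/
theorem sum {ι : Type*} (s : Finset ι) {f : ι → UnitAddTorus d → F} {Cf : ι → ℝ}
    (h : ∀ i ∈ s, HasLiftDerivBounds n (f i) (Cf i) L) (hL : 0 ≤ L) :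
    HasLiftDerivBounds n (fun y => ∑ i ∈ s, f i y) (∑ i ∈ s, Cf i) L := by
  classical
  induction s using Finset.induction_on with
  | empty => simpa using hasLiftDerivBounds_zero (d := d) (F := F) n hL
  | insert i s hi ih =>
    have h1 := (h i (Finset.mem_insert_self i s)).add (ih fun j hj => h j (Finset.mem_insert_of_mem hj))
    simpa [Finset.sum_insert hi] using h1

end HasLiftDerivBounds

end Linear

/-! ## Linear maps, coordinates, Pi- and Euclidean-valued maps -/

section Maps

variable {n : ℕ} {f : UnitAddTorus d → F} {C L : ℝ}

omit [DecidableEq d] in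
/-- Post-composition with a continuous linear map: amplitude `‖φ‖ C`. [folklore] -/
theorem HasLiftDerivBounds.clm_comp (hf : HasLiftDerivBounds n f C L) (φ : F →L[ℝ] G) :
    HasLiftDerivBounds n (fun y => φ (f y)) (‖φ‖ * C) L := by
  refine ⟨φ.contDiff.comp hf.1, fun i hi y => ?_⟩
  have hl : lift (fun y => φ (f y)) = φ ∘ lift f := rfl
  rw [hl, mul_assoc]
  exact (φ.norm_iteratedFDeriv_comp_left hf.contDiff.contDiffAt (by exact_mod_cast hi)).trans
    (mul_le_mul_of_nonneg_left (hf.bound hi y) (norm_nonneg _))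

omit [DecidableEq d] in
/-- A coordinate of a Pi-valued map (sup norm): same constants. [folklore] -/
theorem HasLiftDerivBounds.pi_apply {α : Type*} [Fintype α] {E' : α → Type*}
    [∀ a, NormedAddCommGroup (E' a)] [∀ a, NormedSpace ℝ (E' a)]
    {T : UnitAddTorus d → ∀ a, E' a} (hT : HasLiftDerivBounds n T C L) (a : α) :
    HasLiftDerivBounds n (fun y => T y a) C L := by
  have h := hT.clm_comp (ContinuousLinearMap.proj (R := ℝ) (φ := E') a)
  refine ⟨h.1, fun i hi y => (h.bound hi y).trans ?_⟩
  have hn : ‖(ContinuousLinearMap.proj (R := ℝ) (φ := E') a)‖ ≤ 1 :=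
    ContinuousLinearMap.opNorm_le_bound _ zero_le_one fun v => by
      rw [one_mul]; exact norm_le_pi_norm v a
  have h0 : 0 ≤ C * L ^ i := le_trans (norm_nonneg _) (hT.bound hi y)
  calc ‖ContinuousLinearMap.proj (R := ℝ) (φ := E') a‖ * C * L ^ i ≤ 1 * C * L ^ i := by
        rw [mul_assoc, mul_assoc]; exact mul_le_mul_of_nonneg_right hn h0
    _ = C * L ^ i := by rw [one_mul]

omit [DecidableEq d] in
/-- **Reassembly of a Pi-valued map from its coordinates** (sup norm): if every coordinate obeys the
bounds with constants `C, L` then so does the map, with the SAME constants. [folklore] -/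
theorem HasLiftDerivBounds.of_pi {α : Type*} [Fintype α] {E' : α → Type*}
    [∀ a, NormedAddCommGroup (E' a)] [∀ a, NormedSpace ℝ (E' a)]
    {T : UnitAddTorus d → ∀ a, E' a} (h : ∀ a, HasLiftDerivBounds n (fun y => T y a) C L)
    (hC : 0 ≤ C) (hL : 0 ≤ L) : HasLiftDerivBounds n T C L := by
  have hs : IsSmooth T := contDiff_pi.2 fun a => (h a).1
  refine ⟨hs, fun i hi y => ?_⟩
  refine ContinuousMultilinearMap.opNorm_le_bound (by positivity) fun v => ?_
  refine (pi_norm_le_iff_of_nonneg (by positivity)).2 fun a => ?_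
  have hcomp : (fun y => T y a) ∘ proj = (ContinuousLinearMap.proj (R := ℝ) (φ := E') a) ∘ lift T := rfl
  have h1 : iteratedFDeriv ℝ i (lift fun y => T y a) y =
      (ContinuousLinearMap.proj (R := ℝ) (φ := E') a).compContinuousMultilinearMap
        (iteratedFDeriv ℝ i (lift T) y) := by
    rw [show lift (fun y => T y a) = (fun y => T y a) ∘ proj from rfl, hcomp]
    exact ContinuousLinearMap.iteratedFDeriv_comp_left _ hs.contDiffAt (by exact_mod_cast le_top)
  have h2 : (iteratedFDeriv ℝ i (lift T) y) v a = (iteratedFDeriv ℝ i (lift fun y => T y a) y) v := by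
    rw [h1]; rfl
  rw [h2]
  exact (ContinuousMultilinearMap.le_opNorm _ _).trans
    (mul_le_mul_of_nonneg_right ((h a).bound hi y) (Finset.prod_nonneg fun _ _ => norm_nonneg _))

omit [DecidableEq d] in
/-- A coordinate of a Euclidean-valued map: same constants. [folklore] -/
theorem HasLiftDerivBounds.apply_coord {m : Type*} [Fintype m] {u : UnitAddTorus d → EuclideanSpace ℝ m}
    (hu : HasLiftDerivBounds n u C L) (i : m) : HasLiftDerivBounds n (fun y => u y i) C L := by
  have h := hu.clm_comp (EuclideanSpace.proj i)
  refine ⟨h.1, fun k hk y => (h.bound hk y).trans ?_⟩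
  have hn : ‖(EuclideanSpace.proj i : EuclideanSpace ℝ m →L[ℝ] ℝ)‖ ≤ 1 := by
    refine ContinuousLinearMap.opNorm_le_bound _ zero_le_one fun v => ?_
    rw [one_mul]
    exact PiLp.norm_apply_le v i
  have : 0 ≤ C * L ^ k := le_trans (norm_nonneg _) (hu.bound hk y)
  calc ‖(EuclideanSpace.proj i : EuclideanSpace ℝ m →L[ℝ] ℝ)‖ * C * L ^ k ≤ 1 * C * L ^ k := by
        rw [mul_assoc, mul_assoc]; exact mul_le_mul_of_nonneg_right hn this
    _ = C * L ^ k := by rw [one_mul]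

omit [DecidableEq d] in
/-- A real function times a fixed vector: amplitude `C ‖v‖`. [folklore] -/
theorem HasLiftDerivBounds.smul_const {f : UnitAddTorus d → ℝ} (hf : HasLiftDerivBounds n f C L) (v : G) :
    HasLiftDerivBounds n (fun y => f y • v) (C * ‖v‖) L := by
  have h := hf.clm_comp ((ContinuousLinearMap.id ℝ ℝ).smulRight v)
  have hn : ‖(ContinuousLinearMap.id ℝ ℝ).smulRight v‖ ≤ ‖v‖ := by
    refine ContinuousLinearMap.opNorm_le_bound _ (norm_nonneg _) fun t => ?_
    simp [norm_smul, mul_comm]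
  refine ⟨h.1, fun i hi y => (h.bound hi y).trans ?_⟩
  have : 0 ≤ C * L ^ i := le_trans (norm_nonneg _) (hf.bound hi y)
  calc ‖(ContinuousLinearMap.id ℝ ℝ).smulRight v‖ * C * L ^ i ≤ ‖v‖ * C * L ^ i := by
        rw [mul_assoc, mul_assoc]; exact mul_le_mul_of_nonneg_right hn this
    _ = C * ‖v‖ * L ^ i := by ring

omit [DecidableEq d] in
/-- **Reassembly of a Euclidean-valued map from its coordinates**: amplitude `(card m) C`
(`u = ∑ᵢ uᵢ eᵢ`). [folklore] -/
theorem HasLiftDerivBounds.euclidean_of_coord {m : Type*} [Fintype m] [DecidableEq m]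
    {u : UnitAddTorus d → EuclideanSpace ℝ m} (h : ∀ i, HasLiftDerivBounds n (fun y => u y i) C L)
    (hL : 0 ≤ L) : HasLiftDerivBounds n u (Fintype.card m * C) L := by
  have hrep : u = fun y => ∑ i, u y i • EuclideanSpace.single i (1 : ℝ) := by
    funext y
    have h := (EuclideanSpace.basisFun m ℝ).sum_repr (u y)
    simp only [EuclideanSpace.basisFun_repr, EuclideanSpace.basisFun_apply] at h
    exact h.symm
  have hterm : ∀ i ∈ (Finset.univ : Finset m),
      HasLiftDerivBounds n (fun y => u y i • EuclideanSpace.single i (1 : ℝ)) C L := by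
    intro i _
    have := (h i).smul_const (EuclideanSpace.single i (1 : ℝ))
    simpa using this
  have hs := HasLiftDerivBounds.sum Finset.univ hterm hL
  rw [Finset.sum_const, Finset.card_univ, nsmul_eq_mul] at hs
  rw [hrep]
  exact hs

end Maps

/-! ## Products: amplitudes multiply, frequencies add -/

section Products

variable {n : ℕ} {Cf Cg Lf Lg : ℝ}

/-- The binomial identity behind the product rules:
`∑_b (a choose b) (C_f L_fᵇ)(C_g L_g^{a-b}) = C_f C_g (L_f + L_g)ᵃ`. [folklore] -/
theorem sum_choose_mul_pow_eq (a : ℕ) (Cf Cg Lf Lg : ℝ) :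
    ∑ b ∈ Finset.range (a + 1), (a.choose b : ℝ) * (Cf * Lf ^ b) * (Cg * Lg ^ (a - b)) =
      Cf * Cg * (Lf + Lg) ^ a := by
  rw [add_pow, Finset.mul_sum]
  exact Finset.sum_congr rfl fun b _ => by ring

omit [DecidableEq d] in
/-- **Products of real functions**: `HasLiftDerivBounds n (fg) (C_f C_g) (L_f + L_g)` (Leibniz rule,
Mathlib's `norm_iteratedFDeriv_mul_le`, and the binomial theorem). [cite: Evans2010, §5.3 (Leibniz formula)] -/
theorem HasLiftDerivBounds.mul {f g : UnitAddTorus d → ℝ} (hf : HasLiftDerivBounds n f Cf Lf)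
    (hg : HasLiftDerivBounds n g Cg Lg) :
    HasLiftDerivBounds n (fun y => f y * g y) (Cf * Cg) (Lf + Lg) := by
  refine ⟨?_, fun a ha y => ?_⟩
  · exact hf.1.mul hg.1
  have hl : lift (fun y => f y * g y) = fun y => lift f y * lift g y := rfl
  rw [hl]
  have h := norm_iteratedFDeriv_mul_le hf.contDiff hg.contDiff y (n := a) (by exact_mod_cast ha)
  refine h.trans (le_of_le_of_eq (Finset.sum_le_sum fun b hb => ?_) (sum_choose_mul_pow_eq a Cf Cg Lf Lg))
  have hba : b ≤ a := Nat.lt_succ_iff.1 (Finset.mem_range.1 hb)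
  have h1 := hf.bound (hba.trans ha) y
  have h2 := hg.bound ((Nat.sub_le a b).trans ha) y
  have : 0 ≤ Cf * Lf ^ b := le_trans (norm_nonneg _) h1
  gcongr

omit [DecidableEq d] in
/-- **Scalar times vector**: `HasLiftDerivBounds n (f • g) (C_f C_g) (L_f + L_g)` for real `f` and
`F`-valued `g`. [cite: Evans2010, §5.3 (Leibniz formula)] -/
theorem HasLiftDerivBounds.smul {f : UnitAddTorus d → ℝ} {g : UnitAddTorus d → F}
    (hf : HasLiftDerivBounds n f Cf Lf) (hg : HasLiftDerivBounds n g Cg Lg) :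
    HasLiftDerivBounds n (fun y => f y • g y) (Cf * Cg) (Lf + Lg) := by
  refine ⟨hf.1.smul' hg.1, fun a ha y => ?_⟩
  have hl : lift (fun y => f y • g y) = fun y => lift f y • lift g y := rfl
  rw [hl]
  have h := norm_iteratedFDeriv_smul_le hf.contDiff hg.contDiff y (n := a) (by exact_mod_cast ha)
  refine h.trans (le_of_le_of_eq (Finset.sum_le_sum fun b hb => ?_) (sum_choose_mul_pow_eq a Cf Cg Lf Lg))
  have hba : b ≤ a := Nat.lt_succ_iff.1 (Finset.mem_range.1 hb)
  have h1 := hf.bound (hba.trans ha) y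
  have h2 := hg.bound ((Nat.sub_le a b).trans ha) y
  have : 0 ≤ Cf * Lf ^ b := le_trans (norm_nonneg _) h1
  gcongr

omit [DecidableEq d] in
/-- Products at a common frequency: `HasLiftDerivBounds n (fg) (C_f C_g) (2L)`. [folklore] -/
theorem HasLiftDerivBounds.mul_same {f g : UnitAddTorus d → ℝ} {L : ℝ} (hf : HasLiftDerivBounds n f Cf L)
    (hg : HasLiftDerivBounds n g Cg L) :
    HasLiftDerivBounds n (fun y => f y * g y) (Cf * Cg) (2 * L) := by
  simpa [two_mul] using hf.mul hg

end Products

/-! ## Dilations and translations -/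

section Dilation

variable {n : ℕ} {f : UnitAddTorus d → F} {C L : ℝ}

omit [DecidableEq d] in
/-- **Integer dilations**: `x ↦ f(M • x)` obeys the bounds with `L ↦ M L` (chain rule with the linear
map `y ↦ My` of norm `M`; the factor `M_k^m` of Lemma 3.2 (1) for `φ̃_j(M_k x)`).
[cite: CoiculescuPalasek2025, Lemma 3.2 (1) (proof)] -/
theorem HasLiftDerivBounds.comp_nsmul (hf : HasLiftDerivBounds n f C L) (M : ℕ) :
    HasLiftDerivBounds n (fun x => f (M • x)) C (M * L) := by
  -- the covering map intertwines the two dilations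
  have hproj : ∀ y : EuclideanSpace ℝ d, proj ((M : ℝ) • y) = M • proj y := by
    intro y
    funext i
    rw [proj_smul_apply, Pi.smul_apply, proj_apply, ← nsmul_eq_mul, AddCircle.coe_nsmul]
  set Λ : EuclideanSpace ℝ d →L[ℝ] EuclideanSpace ℝ d := (M : ℝ) • ContinuousLinearMap.id ℝ _ with hΛ
  have hlift : lift (fun x => f (M • x)) = lift f ∘ Λ := by
    funext y
    simp only [lift_apply, comp_apply, hΛ, FunLike.coe_smul, Pi.smul_apply, ContinuousLinearMap.id_apply, hproj]
  have hΛn : ‖Λ‖ ≤ M := by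
    refine ContinuousLinearMap.opNorm_le_bound _ (Nat.cast_nonneg M) fun y => ?_
    rw [hΛ, FunLike.coe_smul, Pi.smul_apply, ContinuousLinearMap.id_apply, norm_smul, Real.norm_natCast]
  refine ⟨?_, fun i hi y => ?_⟩
  · show ContDiff ℝ ∞ (lift fun x => f (M • x))
    rw [hlift]; exact hf.1.comp Λ.contDiff
  rw [hlift, Λ.iteratedFDeriv_comp_right hf.contDiff y (by exact_mod_cast hi)]
  refine (ContinuousMultilinearMap.norm_compContinuousLinearMap_le _ _).trans ?_
  rw [Finset.prod_const, Finset.card_univ, Fintype.card_fin]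
  calc ‖iteratedFDeriv ℝ i (lift f) (Λ y)‖ * ‖Λ‖ ^ i ≤ C * L ^ i * (M : ℝ) ^ i := by
        refine mul_le_mul (hf.bound hi _) (pow_le_pow_left₀ (norm_nonneg _) hΛn i)
          (pow_nonneg (norm_nonneg _) i) ?_
        exact le_trans (norm_nonneg _) (hf.bound hi (Λ y))
    _ = C * ((M : ℝ) * L) ^ i := by rw [mul_pow]; ring

omit [DecidableEq d] in
/-- Translations `x ↦ f(x - s)`: same constants. [folklore] -/
theorem HasLiftDerivBounds.comp_sub_const (hf : HasLiftDerivBounds n f C L) (s : UnitAddTorus d) :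
    HasLiftDerivBounds n (fun x => f (x - s)) C L := by
  obtain ⟨a, rfl⟩ := proj_surjective s
  have hlift : lift (fun x => f (x - proj a)) = fun y => lift f (y - a) := by
    funext y
    simp only [lift_apply, sub_eq_add_neg, proj_add, proj_neg]
  refine ⟨?_, fun i hi y => ?_⟩
  · show ContDiff ℝ ∞ (lift fun x => f (x - proj a))
    rw [hlift]; exact hf.1.comp (contDiff_id.sub contDiff_const)
  rw [hlift, iteratedFDeriv_comp_sub]
  exact hf.bound hi _

omit [DecidableEq d] in
/-- Translations `x ↦ f(x + s)`: same constants. [folklore] -/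
theorem HasLiftDerivBounds.comp_add_const (hf : HasLiftDerivBounds n f C L) (s : UnitAddTorus d) :
    HasLiftDerivBounds n (fun x => f (x + s)) C L := by
  simpa [sub_neg_eq_add] using hf.comp_sub_const (-s)

end Dilation

/-! ## Derivatives: the order drops by one, the amplitude gains a factor `L` -/

section Derivatives

variable {n : ℕ} {f : UnitAddTorus d → F} {C L : ℝ}

omit [DecidableEq d] in
/-- **Directional derivatives**: from order `n + 1` bounds on `f`, order `n` bounds on `∂_v f` with
amplitude `C L ‖v‖`. [folklore] -/
theorem HasLiftDerivBounds.lineDeriv (hf : HasLiftDerivBounds (n + 1) f C L)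
    (v : EuclideanSpace ℝ d) : HasLiftDerivBounds n (fun x => Torus.lineDeriv f x v) (C * L * ‖v‖) L := by
  have h1 : IsContDiff 1 f := hf.1.isContDiff (by simp)
  refine ⟨hf.1.lineDeriv v, fun i hi y => ?_⟩
  rw [lift_lineDeriv h1 v]
  have hD : ContDiff ℝ i (_root_.fderiv ℝ (lift f)) :=
    (hf.1.fderiv_right (m := i) (by exact_mod_cast le_top))
  calc ‖iteratedFDeriv ℝ i (fun y => _root_.fderiv ℝ (lift f) y v) y‖
      ≤ ‖v‖ * ‖iteratedFDeriv ℝ i (_root_.fderiv ℝ (lift f)) y‖ :=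
        norm_iteratedFDeriv_clm_apply_const hD.contDiffAt (by exact_mod_cast le_rfl)
    _ = ‖v‖ * ‖iteratedFDeriv ℝ (i + 1) (lift f) y‖ := by rw [norm_iteratedFDeriv_fderiv]
    _ ≤ ‖v‖ * (C * L ^ (i + 1)) := mul_le_mul_of_nonneg_left (hf.bound (by omega) y) (norm_nonneg _)
    _ = C * L * ‖v‖ * L ^ i := by ring

/-- **Partial derivatives**: from order `n + 1` bounds on `f`, order `n` bounds on `∂ᵢ f` with
amplitude `C L`. [folklore] -/
theorem HasLiftDerivBounds.partialDeriv (hf : HasLiftDerivBounds (n + 1) f C L) (i : d) :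
    HasLiftDerivBounds n (Torus.partialDeriv i f) (C * L) L := by
  have h := hf.lineDeriv (EuclideanSpace.single i (1 : ℝ))
  have hn : ‖(EuclideanSpace.single i (1 : ℝ) : EuclideanSpace ℝ d)‖ = 1 := by simp
  rw [hn, mul_one] at h
  exact h

/-- Read-out: `‖∂ᵢ f‖_∞ ≤ C L` from order-one bounds. [folklore] -/
theorem HasLiftDerivBounds.norm_partialDeriv_le (hf : HasLiftDerivBounds (n + 1) f C L)
    (i : d) (x : UnitAddTorus d) : ‖Torus.partialDeriv i f x‖ ≤ C * L :=
  (hf.partialDeriv i).norm_le x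

end Derivatives

/-! ## Mollification -/

section Mollify

variable {n : ℕ} {f : UnitAddTorus d → F} {C L ε : ℝ} [CompleteSpace F]

omit [DecidableEq d] in
/-- **Mollification preserves the bounds** (all derivatives on the function: Evans App. C.4 Thm. 7,
`Torus.norm_iteratedFDeriv_lift_kernel_convolution_le_of_forall_le'`; the "`L^∞` boundedness of the
mollifier `φ_k ∗`" of the proof of Lemma 3.6). [cite: Evans2010, App. C.4 Thm. 7] -/
theorem HasLiftDerivBounds.kernel_convolution (hf : HasLiftDerivBounds n f C L) (hε : 0 < ε)
    (hε' : ε ≤ 1 / 4) : HasLiftDerivBounds n (kernel ε ⋆ f) C L :=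
  ⟨isSmooth_convolution (isSmooth_kernel hε hε').integrable hf.1, fun _ hi y =>
    norm_iteratedFDeriv_lift_kernel_convolution_le_of_forall_le' hε hε' hf.1 (fun z => hf.bound hi z) y⟩

variable (d) in
/-- A common bound `c̄_n ≥ 1` for the kernel-derivative masses `c_i = Torus.derivProfileMass d i`,
`i ≤ n` (so that `c_i ε⁻ⁱ ≤ (c̄_n/ε)ⁱ` for `ε ≤ 1`). [folklore] -/
def derivProfileMassSup : ℕ → ℝ
  | 0 => 1
  | n + 1 => max (derivProfileMassSup n) (derivProfileMass d (n + 1))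

omit [DecidableEq d] in
/-- `1 ≤ c̄_n`. [folklore] -/
theorem one_le_derivProfileMassSup (n : ℕ) : 1 ≤ derivProfileMassSup d n := by
  induction n with
  | zero => simp [derivProfileMassSup]
  | succ n ih => exact ih.trans (le_max_left _ _)

omit [DecidableEq d] in
/-- `c_i ≤ c̄_n` for `i ≤ n`. [folklore] -/
theorem derivProfileMass_le_sup {i n : ℕ} (hi : i ≤ n) : derivProfileMass d i ≤ derivProfileMassSup d n := by
  induction n with
  | zero =>
    rw [Nat.le_zero.1 hi, derivProfileMass_zero]
    simp [derivProfileMassSup]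
  | succ n ih =>
    rcases Nat.lt_or_ge i (n + 1) with h | h
    · exact (ih (Nat.lt_succ_iff.1 h)).trans (le_max_left _ _)
    · rw [le_antisymm hi h]; exact le_max_right _ _

omit [DecidableEq d] [CompleteSpace F] in
/-- **Mollification from a sup bound alone, all derivatives on the kernel**: for smooth `f` with
`‖f‖_∞ ≤ A` and `0 < ε ≤ 1/4`, `HasLiftDerivBounds n (k_ε ⋆ f) A (c̄_n/ε)` (Evans App. C.4 Thm. 7:
`‖Dⁱ(k_ε ⋆ f)‖ ≤ c_i ε⁻ⁱ ‖f‖_∞`; the bound "placing derivatives on the mollifier" of the proof of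
Prop. 3.7, `‖∇𝒟ψ⁰_{k-1}‖_∞ ≲ ℓ_{k-1}⁻¹`). [cite: Evans2010, App. C.4 Thm. 7] -/
theorem hasLiftDerivBounds_kernel_convolution_of_norm_le (hf : IsSmooth f) {A : ℝ} (hA : ∀ x, ‖f x‖ ≤ A)
    (hε : 0 < ε) (hε' : ε ≤ 1 / 4) (n : ℕ) :
    HasLiftDerivBounds n (kernel ε ⋆ f) A (derivProfileMassSup d n / ε) := by
  have hA0 : 0 ≤ A := (norm_nonneg _).trans (hA 0)
  refine ⟨isSmooth_convolution (isSmooth_kernel hε hε').integrable hf, fun i hi y => ?_⟩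
  refine (norm_iteratedFDeriv_lift_kernel_convolution_le_of_forall_le hε hε' hf i y hA).trans ?_
  -- `c_i ≤ c̄_n ≤ c̄_nⁱ` for `1 ≤ i`; for `i = 0` both sides are `1`
  have hci : derivProfileMass d i ≤ derivProfileMassSup d n ^ i := by
    rcases Nat.eq_zero_or_pos i with rfl | hpos
    · rw [derivProfileMass_zero, pow_zero]
    · calc derivProfileMass d i ≤ derivProfileMassSup d n := derivProfileMass_le_sup hi
        _ = derivProfileMassSup d n ^ 1 := (pow_one _).symm
        _ ≤ derivProfileMassSup d n ^ i :=
            pow_le_pow_right₀ (one_le_derivProfileMassSup n) hpos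
  rw [div_pow, div_eq_mul_inv]
  calc derivProfileMass d i * (ε ^ i)⁻¹ * A ≤ derivProfileMassSup d n ^ i * (ε ^ i)⁻¹ * A := by
        gcongr
    _ = A * (derivProfileMassSup d n ^ i * (ε ^ i)⁻¹) := by ring

end Mollify

/-! ## Building the predicate from pointwise bounds -/

section Build

variable {n : ℕ} {f : UnitAddTorus d → F} {C L : ℝ}

omit [DecidableEq d] in
/-- From non-geometric bounds `‖Dⁱ(f∘proj)‖ ≤ G i` (`i ≤ n`): `HasLiftDerivBounds n f (max_i G i) 1`-type
packaging with `L = 1` and `C` any common bound of the `G i`. [folklore] -/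
theorem hasLiftDerivBounds_of_forall_le_one (hf : IsSmooth f) {G : ℕ → ℝ}
    (hG : ∀ i ≤ n, ∀ y, ‖iteratedFDeriv ℝ i (lift f) y‖ ≤ G i) (hC : ∀ i ≤ n, G i ≤ C) :
    HasLiftDerivBounds n f C 1 :=
  ⟨hf, fun i hi y => by rw [one_pow, mul_one]; exact (hG i hi y).trans (hC i hi)⟩

omit [DecidableEq d] in
/-- From geometric bounds with a non-geometric amplitude profile: if `‖Dⁱ(f∘proj)‖ ≤ G i * Lⁱ` for
`i ≤ n` and `G i ≤ C` then `HasLiftDerivBounds n f C L` (`L ≥ 0`). [folklore] -/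
theorem hasLiftDerivBounds_of_forall_le (hf : IsSmooth f) {G : ℕ → ℝ} (hL : 0 ≤ L)
    (hG : ∀ i ≤ n, ∀ y, ‖iteratedFDeriv ℝ i (lift f) y‖ ≤ G i * L ^ i) (hC : ∀ i ≤ n, G i ≤ C) :
    HasLiftDerivBounds n f C L :=
  ⟨hf, fun i hi y => (hG i hi y).trans (mul_le_mul_of_nonneg_right (hC i hi) (pow_nonneg hL i))⟩

end Build

end Torus

end Literature.Analysis.FunctionSpaces
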